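import Literature.AlgebraicGeometry.Motives.AbelianVarietyFrobeniusTwistVariety
import Literature.AlgebraicGeometry.Motives.AbelianVarietyFrobeniusTwist
import HarnessLib

/-!
# Factorisation through the relative Frobenius: a morphism whose comorphism lands in `q`-th powers
# factors (uniquely) through `F_{X/k} : X → X^{(q)}` (Görtz–Wedhorn Rem./Def. 4.24; Milne, *Étale cohomology* VI §13)

Topic `Literature/AlgebraicGeometry/Motives`, namespace `Literature.AlgebraicGeometry.Motives`.
THEOREMS ONLY, all proved; no definition, no named fact, no instance, no notation (net Literature debt **0**).
Written for the cell `hodgecm-mathlib` (D-0151), fan B-II, E2 «height-one road» of A-p02's memo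
`ROAD-E2-heightOne-S2degOne.md` §2, piece **HO-sch** (the scheme half of Shimura 1998 §2.8 Prop. 6 (i): «if `δλ = 0`
then `λ` factors through the `p`-th power map»), on top of B-p12's `AbelianVarietyFrobeniusTwistVariety`
(`absFrobeniusOver`, `frobeniusTwistOver`, `twistFst`, `relFrobeniusOver`), the tree's `powEndo` (`FrobeniusMorphism`) and its
epimorphy on reduced schemes `epi_powEndo` (`AbelianVarietyFrobeniusTwist`).

## Mathematics

Let `X` be a REDUCED scheme on whose rings of sections `s ↦ sⁿ` is additive (`n ≠ 0`; the case of interest is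
`n = q = pʳ` on a scheme of characteristic `p`), and let `f : X → Y` be a morphism of schemes such that every
pulled-back section `f♯(s) ∈ Γ(X, f⁻¹V)` (`s ∈ Γ(Y, V)`) is an `n`-th power.  Since `X` is reduced, `n`-th roots in
its rings of sections are UNIQUE (the tree's `pow_injective_of_isReduced`: `xⁿ = yⁿ ⇒ (x - y)ⁿ = 0 ⇒ x = y`), so
`s ↦ ⁿ√(f♯ s)` is a ring homomorphism (`exists_ringHom_forall_pow_eq`) compatible with restrictions and with local
stalk maps: it is the comorphism of a morphism of schemes `ⁿ√f : X → Y` with the same underlying continuous map as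
`f`, and

* `F_X ≫ ⁿ√f = f` (`exists_powEndo_comp_eq`), where `F_X = powEndo X n` is the `n`-th power endomorphism
  (identity on points, `s ↦ sⁿ` on functions);
* `F_X` is an EPIMORPHISM of schemes for `X` reduced (the tree's `epi_powEndo`, `AbelianVarietyFrobeniusTwist`), so the
  factorisation is unique
  (`existsUnique_powEndo_comp_eq`).

Over a PERFECT field `k` of exponential characteristic `p` (`q = pⁿ`), the projection `pr_X : X^{(q)} → X` of the
Frobenius twist is an isomorphism of schemes (base change along the automorphism `Frobⁿ` of `k`;
`isIso_twistFst`), the relative Frobenius `F_{X/k} = F_X^{abs} ≫ pr_X⁻¹` is therefore an epimorphism of schemes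
for `X` reduced (`epi_relFrobeniusOver_left`), and **every `k`-morphism `f : X → Y` whose comorphism lands in
`q`-th powers factors uniquely through `F_{X/k}`**: `f = F_{X/k} ≫ g` with `g := pr_X ≫ ⁿ√f : X^{(q)} → Y`, which IS
a `k`-morphism because `F_{X/k}` is epi and both `g ≫ (Y → Spec k)` and `X^{(q)} → Spec k` pull back along
`F_{X/k}` to `X → Spec k` (`exists_eq_relFrobeniusOver_comp`, `existsUnique_eq_relFrobeniusOver_comp`).
(Over an imperfect field the `k`-linearity of the factor can fail: `X = Spec k^{1/p} → Y = Spec k[y]`; perfectness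
is what the consumer — abelian varieties over a finite residue field, Shimura §18.6 p. 129 — has.)

## References
* [Milne2025] J. S. Milne, *Étale cohomology*, VI §13, Rem. 13.5 (relative Frobenius `F_{X/k}`, `X^{(p)}`).
* [GortzWedhorn2020] U. Görtz, T. Wedhorn, *Algebraic Geometry I* (2nd ed.), Remark/Definition 4.24 (absolute and relative Frobenius,
  `X^{(p)}`, `F_{X/S}`; p. 107), Exercise 4.17, Exercise 15.8 (a purely inseparable morphism of curves over a perfect field is a
  Frobenius power followed by an isomorphism).
* [SGA5] A. Grothendieck et al., SGA 5, Exp. XV §1 (Frobenius absolu et relatif) — background only, not a bib key.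
* [Shimura1998] G. Shimura, *Abelian Varieties with Complex Multiplication and Modular Functions*, §2.8 Prop. 6 (i)
  (`δλ = 0 ⇔ k(λx) ⊆ k(xᵖ)`), §18.6 p. 129 (`λ̃ = ψ ∘ π`).
* [Hartshorne1977] R. Hartshorne, *Algebraic Geometry*, IV §2 Rem. 2.4.1 (`k`-linear Frobenius).
-/

noncomputable section

set_option backward.isDefEq.respectTransparency false

universe u

open CategoryTheory CategoryTheory.Limits AlgebraicGeometry Opposite

namespace Literature.AlgebraicGeometry.Motives

/-! ### §1. Unique `n`-th roots in reduced rings with additive `n`-th power -/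

section RootAlgebra

variable {R S : Type*} [CommRing R] [CommRing S]

/-- **The `n`-th root of a ring homomorphism.**  If `φ : S → R` takes values in `n`-th powers, `R` is reduced and
`s ↦ sⁿ` is additive on `R` (`n ≠ 0`), then `s ↦ ⁿ√(φ s)` (the unique `t` with `tⁿ = φ s`) is a ring homomorphism
`ψ` with `ψ(s)ⁿ = φ(s)`: uniqueness of `n`-th roots makes it multiplicative and additive. [folklore] -/
private theorem exists_ringHom_forall_pow_eq [IsReduced R] (n : ℕ) (hn : n ≠ 0)
    (hadd : ∀ a b : R, (a + b) ^ n = a ^ n + b ^ n) (φ : S →+* R) (hφ : ∀ s : S, ∃ t : R, t ^ n = φ s) :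
    ∃ ψ : S →+* R, ∀ s : S, (ψ s) ^ n = φ s := by
  let ψ : S →+* R :=
    { toFun := fun s => (hφ s).choose
      map_one' := pow_injective_of_isReduced hadd (by
        show (hφ 1).choose ^ n = (1 : R) ^ n
        rw [(hφ 1).choose_spec, map_one, one_pow])
      map_mul' := fun s t => pow_injective_of_isReduced hadd (by
        show (hφ (s * t)).choose ^ n = ((hφ s).choose * (hφ t).choose) ^ n
        rw [(hφ (s * t)).choose_spec, mul_pow, (hφ s).choose_spec, (hφ t).choose_spec, map_mul])
      map_zero' := pow_injective_of_isReduced hadd (by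
        show (hφ 0).choose ^ n = (0 : R) ^ n
        rw [(hφ 0).choose_spec, map_zero, zero_pow hn])
      map_add' := fun s t => pow_injective_of_isReduced hadd (by
        show (hφ (s + t)).choose ^ n = ((hφ s).choose + (hφ t).choose) ^ n
        rw [(hφ (s + t)).choose_spec, hadd, (hφ s).choose_spec, (hφ t).choose_spec, map_add]) }
  exact ⟨ψ, fun s => (hφ s).choose_spec⟩

end RootAlgebra

/-! ### §2. Factorisation through the power endomorphism of a reduced scheme -/

section Scheme

variable {X Y : Scheme.{u}}

variable [IsReduced X] (n : ℕ) (hn : n ≠ 0)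
  (hadd : ∀ (U : X.Opens) (a b : Γ(X, U)), (a + b) ^ n = a ^ n + b ^ n)
  (f : X ⟶ Y) (hf : ∀ (U : Y.Opens) (s : Γ(Y, U)), ∃ t : Γ(X, f ⁻¹ᵁ U), t ^ n = f.app U s)

include hf in
/-- **Factorisation through the power endomorphism.**  A morphism `f : X → Y` from a REDUCED scheme with additive
`n`-th power (`n ≠ 0`) whose comorphism lands in `n`-th powers factors as `f = F_X ≫ g` through the `n`-th power
endomorphism `F_X`, with `g = ⁿ√f`: the continuous map of `f` and the comorphism `s ↦ ⁿ√(f♯ s)` (so `(g♯ s)ⁿ = f♯ s`);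
`g` is a morphism of schemes because `ⁿ√` is natural (restrictions commute with the unique roots) and its stalk maps
are local (`g_x(a)ⁿ = f_x(a)` and `f_x` is local).
[cite: GortzWedhorn2020, Remark/Definition 4.24 and Exercise 15.8 (factorisation through a Frobenius power)] [cite: Shimura1998, §2.8 Prop. 6 (i)] -/
theorem exists_powEndo_comp_eq : ∃ g : X ⟶ Y, powEndo X n hn hadd ≫ g = f := by
  -- the root homomorphisms, open by open
  choose ψ hψ using fun U : Y.Opens =>
    exists_ringHom_forall_pow_eq (R := Γ(X, f ⁻¹ᵁ U)) n hn (hadd _) (f.app U).hom (hf U)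
  have huniq : ∀ (U : Y.Opens) (s : Γ(Y, U)) (t : Γ(X, f ⁻¹ᵁ U)), t ^ n = (f.app U).hom s → t = ψ U s :=
    fun U s t ht => pow_injective_of_isReduced (hadd _) (ht.trans (hψ U s).symm)
  -- the comorphism `s ↦ ⁿ√(f♯ s)`
  let c : Y.presheaf ⟶ f.base _* X.presheaf :=
    { app := fun U => CommRingCat.ofHom (ψ U.unop)
      naturality := fun U V i => by
        ext s
        simp only [CommRingCat.hom_comp, RingHom.comp_apply, CommRingCat.hom_ofHom]
        refine (huniq V.unop _ _ ?_).symm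
        -- `(ⁿ√(f♯ s))|_V ^ n = (f♯ s)|_V = f♯ (s|_V)`
        have h1 : ((X.presheaf.map ((TopologicalSpace.Opens.map f.base).map i.unop).op).hom (ψ U.unop s)) ^ n =
            (X.presheaf.map ((TopologicalSpace.Opens.map f.base).map i.unop).op).hom ((f.app U.unop).hom s) := by
          rw [← map_pow, hψ]
        exact h1.trans (congrArg (fun φ => φ.hom s) (f.naturality i)).symm }
  -- the morphism of schemes `ⁿ√f`
  let g : X ⟶ Y :=
    { base := f.base
      c := c
      prop := fun x => by
        constructor
        intro a ha
        obtain ⟨U, hxU, s, rfl⟩ := Y.presheaf.exists_germ_eq a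
        have h := PresheafedSpace.stalkMap_germ
          ({ base := f.base, c := c } : X.toPresheafedSpace ⟶ Y.toPresheafedSpace) U x hxU
        have h' := DFunLike.congr_fun (CommRingCat.hom_ext_iff.mp h) s
        simp only [CommRingCat.hom_comp, RingHom.comp_apply] at h'
        rw [h'] at ha
        -- `ha : IsUnit (germ (ⁿ√(f♯ s)))`; raise to the `n`-th power
        have hc' : (({ base := f.base, c := c } : X.toPresheafedSpace ⟶ Y.toPresheafedSpace).c.app (op U)).hom s =
            ψ U s := rfl
        rw [hc'] at ha
        have ha' : IsUnit ((X.presheaf.germ (f ⁻¹ᵁ U) x hxU).hom ((ψ U s) ^ n)) := by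
          rw [map_pow]; exact ha.pow n
        rw [hψ] at ha'
        -- `ha' : IsUnit (germ (f♯ s)) = IsUnit (f_x (germ s))`
        rw [← Scheme.Hom.germ_stalkMap_apply f U x hxU s] at ha'
        exact (isUnit_map_iff (f.stalkMap x).hom _).mp ha' }
  refine ⟨g, ?_⟩
  -- `F_X ≫ ⁿ√f = f`: on sections `(ⁿ√(f♯ s))ⁿ = f♯ s`
  refine Scheme.Hom.ext (by rfl) fun U => ?_
  ext s
  change (X.presheaf.map (eqToHom (rfl : f ⁻¹ᵁ U = f ⁻¹ᵁ U)).op).hom ((ψ U s) ^ n) = (f.app U).hom s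
  simp only [eqToHom_refl, op_id, CategoryTheory.Functor.map_id, CommRingCat.hom_id, RingHom.id_apply]
  exact hψ U s

include hf in
/-- **Unique factorisation through the power endomorphism**: a morphism `f : X → Y` from a reduced scheme whose
comorphism lands in `n`-th powers factors UNIQUELY as `f = F_X ≫ g` (`F_X` is epi).
[cite: GortzWedhorn2020, Remark/Definition 4.24 and Exercise 15.8] [cite: Shimura1998, §2.8 Prop. 6 (i)] -/
theorem existsUnique_powEndo_comp_eq : ∃! g : X ⟶ Y, powEndo X n hn hadd ≫ g = f := by
  obtain ⟨g, hg⟩ := exists_powEndo_comp_eq n hn hadd f hf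
  refine ⟨g, hg, fun g' hg' => ?_⟩
  haveI := epi_powEndo X n hn hadd
  exact (cancel_epi (powEndo X n hn hadd)).mp (hg'.trans hg.symm)

end Scheme

/-! ### §3. Over a perfect field: factorisation through the relative Frobenius `F_{X/k} : X → X^{(q)}` -/

section Perfect

variable {k : Type u} [Field k] (p : ℕ) [ExpChar k p] (n : ℕ) [PerfectRing k p]

/-- Over a perfect field, `Spec Frobⁿ : Spec k → Spec k` is an isomorphism (`Frobⁿ = iterateFrobeniusEquiv k p n`).
[cite: Milne2025, VI §13 Rem. 13.5] -/
theorem isIso_frobSpec : IsIso (frobSpec k p n) := by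
  have h : CommRingCat.ofHom (iterateFrobenius k p n) =
      ((iterateFrobeniusEquiv k p n).toCommRingCatIso).hom := rfl
  change IsIso (Spec.map (CommRingCat.ofHom (iterateFrobenius k p n)))
  rw [h]
  infer_instance

variable (X : SchemeOver k)

/-- Over a perfect field, the projection `pr_X : X^{(q)} → X` of the Frobenius twist is an ISOMORPHISM of schemes
(base change of the isomorphism `Spec Frobⁿ`). [cite: Milne2025, VI §13 Rem. 13.5] -/
theorem isIso_twistFst : IsIso (twistFst p n X) := by
  haveI := isIso_frobSpec (k := k) p n
  rw [twistFst_def]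
  infer_instance

/-- Over a perfect field, `F_{X/k} = F_X^{abs} ≫ pr_X⁻¹` on underlying schemes. [cite: Milne2025, VI §13 Rem. 13.5] -/
theorem relFrobeniusOver_left_eq :
    (relFrobeniusOver p n X).left =
      absFrobeniusOver p n X ≫ inv (twistFst p n X) (I := isIso_twistFst p n X) := by
  haveI := isIso_twistFst p n X
  rw [← relFrobeniusOver_left_comp_fst p n X, Category.assoc, IsIso.hom_inv_id, Category.comp_id]

/-- **Over a perfect field, the relative Frobenius of a REDUCED `k`-scheme is an epimorphism of schemes**
(`F_X^{abs}` is epi and `pr_X` is an isomorphism). [cite: GortzWedhorn2020, Remark/Definition 4.24 (relative Frobenius `F_{X/S}`)] [cite: Milne2025, VI §13 Rem. 13.5] -/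
theorem epi_relFrobeniusOver_left [IsReduced X.left] : Epi (relFrobeniusOver p n X).left := by
  haveI := isIso_twistFst p n X
  haveI : Epi (absFrobeniusOver p n X) := epi_powEndo X.left (p ^ n) _ _
  rw [relFrobeniusOver_left_eq p n X]
  exact epi_comp _ _

/-- Over a perfect field, `k`-morphisms out of `X^{(q)}` (for `X` reduced) are determined by their composite with
`F_{X/k}`. [cite: GortzWedhorn2020, Remark/Definition 4.24 (relative Frobenius `F_{X/S}`)] [cite: Milne2025, VI §13 Rem. 13.5] -/
theorem eq_of_relFrobeniusOver_comp_eq [IsReduced X.left] {Y : SchemeOver k}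
    {g₁ g₂ : frobeniusTwistOver p n X ⟶ Y}
    (h : relFrobeniusOver p n X ≫ g₁ = relFrobeniusOver p n X ≫ g₂) : g₁ = g₂ := by
  haveI := epi_relFrobeniusOver_left p n X
  ext : 1
  have h' := congrArg CommaMorphism.left h
  simp only [Over.comp_left] at h'
  exact (cancel_epi (relFrobeniusOver p n X).left).mp h'

variable {X} {Y : SchemeOver k} [IsReduced X.left] (f : X ⟶ Y)
  (hf : ∀ (U : Y.left.Opens) (s : Γ(Y.left, U)), ∃ t : Γ(X.left, f.left ⁻¹ᵁ U), t ^ p ^ n = f.left.app U s)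

include hf in
/-- **HO-sch (A-p02's E2 road memo §2).  A `k`-morphism `f : X → Y` from a REDUCED `k`-scheme over a PERFECT field,
whose comorphism lands in `q`-th powers (`q = pⁿ`), factors through the relative Frobenius:
`f = F_{X/k} ≫ g` for some `k`-morphism `g : X^{(q)} → Y`.**  Construction: `g = pr_X ≫ ⁿ√f` with `ⁿ√f` the
factorisation of `f` through the absolute Frobenius (`exists_powEndo_comp_eq`); it is a `k`-morphism because
`F_{X/k}` is an epimorphism and `F_{X/k} ≫ g ≫ (Y → Spec k) = f ≫ (Y → Spec k) = (X → Spec k) = F_{X/k} ≫ (X^{(q)} → Spec k)`.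
[cite: Shimura1998, §2.8 Prop. 6 (i)] [cite: GortzWedhorn2020, Remark/Definition 4.24 and Exercise 15.8] [cite: Milne2025, VI §13 Rem. 13.5] -/
theorem exists_eq_relFrobeniusOver_comp : ∃ g : frobeniusTwistOver p n X ⟶ Y, f = relFrobeniusOver p n X ≫ g := by
  obtain ⟨g₀, hg₀⟩ := exists_powEndo_comp_eq (p ^ n) (expChar_pow_pos k p n).ne' (add_pow_expChar_pow_sections p n X)
    f.left hf
  haveI := epi_relFrobeniusOver_left p n X
  -- `F_{X/k} ≫ pr_X ≫ g₀ = F_X^{abs} ≫ g₀ = f` on underlying schemes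
  have hfac : (relFrobeniusOver p n X).left ≫ twistFst p n X ≫ g₀ = f.left := by
    rw [← Category.assoc, relFrobeniusOver_left_comp_fst]
    exact hg₀
  refine ⟨Over.homMk (twistFst p n X ≫ g₀) ?_, ?_⟩
  · -- `k`-linearity, tested after the epimorphism `F_{X/k}`
    rw [← cancel_epi (relFrobeniusOver p n X).left, Over.w, ← Category.assoc, hfac, Over.w]
  · ext : 1
    change f.left = (relFrobeniusOver p n X).left ≫ twistFst p n X ≫ g₀
    exact hfac.symm

include hf in
/-- **HO-sch with uniqueness**: the factorisation of `f` through `F_{X/k}` is unique (`F_{X/k}` is epi for `X`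
reduced over a perfect field). [cite: Shimura1998, §2.8 Prop. 6 (i)] [cite: GortzWedhorn2020, Remark/Definition 4.24 and Exercise 15.8] -/
theorem existsUnique_eq_relFrobeniusOver_comp :
    ∃! g : frobeniusTwistOver p n X ⟶ Y, f = relFrobeniusOver p n X ≫ g := by
  obtain ⟨g, hg⟩ := exists_eq_relFrobeniusOver_comp p n f hf
  exact ⟨g, hg, fun g' hg' => eq_of_relFrobeniusOver_comp_eq p n X (hg'.symm.trans hg)⟩

end Perfect

end Literature.AlgebraicGeometry.Motives

end
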